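import Literature.Analysis.Convexity.KestenRatioScheme
import HarnessLib

/-!
# Kesten–Basu–Sapozhnikov IIC scheme in boxes, XV: a supersolution of Kesten's recursion close to `1` (lane RSW3, p1 gen 3)

builds on p205010 (kernel theorem, internal audit signed; external expert review pending)

Seat `prim-rsw3-p1` (gen 3); LANE-4 blueprint, memo `run/shared/lean/prim/rsw3/P1-QM.md` §13.4 step (4).  Helper file; no definitions, no
sorries.  The recursion of `Literature.Analysis.Convexity.KestenRatioScheme.kesten_multilevel_osc_le` is `Q 1 ≥ K (1−ε)⁻²`,
`Q (l+1) ≥ (1/K + (1 − 1/K) Q l)(1−ε)⁻²`; its affine solution is `Q l = Q* + θ^{l−1} (Q 1 − Q*)` with `θ = (1 − 1/K)(1−ε)⁻²`,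
`Q* = (1/K) / ((1−ε)² − 1 + 1/K)`.
* **`exists_kesten_supersolution_le`** — for `K ≥ 1` and `δ > 0` there are `ε₀ ∈ (0,1)` and `L ≥ 1` such that for every junk size
  `ε ∈ [0, ε₀]` some solution `Q` of the recursion has `Q L ≤ 1 + δ`: the oscillation bound of Kesten's scheme can be made as close to `1`
  as desired by taking many levels with small junk.
References: H. Kesten, PTRF 73 (1986) §2, eqs. (24)–(25).
-/

noncomputable section

namespace Summit.CriticalPhenomena.PercolationContinuityZ3.Theorems.Crossing

/-- **A supersolution of Kesten's recursion with `Q L ≤ 1 + δ`.** [cite: Kesten1986, §2 eqs. (24)–(25)] -/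
theorem exists_kesten_supersolution_le {K δ : ℝ} (hK : 1 ≤ K) (hδ : 0 < δ) :
    ∃ ε₀ : ℝ, 0 < ε₀ ∧ ε₀ < 1 ∧ ∃ L : ℕ, 1 ≤ L ∧ ∀ ε : ℝ, 0 ≤ ε → ε ≤ ε₀ →
      ∃ Q : ℕ → ℝ, K / (1 - ε) ^ 2 ≤ Q 1 ∧ (∀ l : ℕ, 1 ≤ l → (1 / K + (1 - 1 / K) * Q l) / (1 - ε) ^ 2 ≤ Q (l + 1)) ∧
        Q L ≤ 1 + δ := by
  have hK0 : 0 < K := by linarith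
  set ε₀ : ℝ := min (1 / (4 * K)) (δ / (8 * K)) with hε₀
  have hε₀pos : 0 < ε₀ := lt_min (by positivity) (by positivity)
  have hε₀1 : ε₀ ≤ 1 / (4 * K) := min_le_left _ _
  have hε₀2 : ε₀ ≤ δ / (8 * K) := min_le_right _ _
  have h4K : 1 / (4 * K) ≤ 1 / 4 := one_div_le_one_div_of_le (by norm_num) (by linarith)
  -- the uniform contraction factor
  set θ₀ : ℝ := (1 - 1 / K) / (1 - 1 / (2 * K)) with hθ₀
  have hden0 : 0 < 1 - 1 / (2 * K) := by
    have : 1 / (2 * K) ≤ 1 / 2 := one_div_le_one_div_of_le (by norm_num) (by linarith)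
    linarith
  have hnum0 : 0 ≤ 1 - 1 / K := by
    have : 1 / K ≤ 1 := by rw [div_le_one hK0]; exact hK
    linarith
  have hθ₀0 : 0 ≤ θ₀ := div_nonneg hnum0 hden0.le
  have hθ₀1 : θ₀ < 1 := by
    rw [hθ₀, div_lt_one hden0]
    have : 1 / (2 * K) < 1 / K := one_div_lt_one_div_of_lt hK0 (by linarith)
    linarith
  obtain ⟨N, hN⟩ := exists_pow_lt_of_lt_one (show 0 < δ / (4 * K) by positivity) hθ₀1
  refine ⟨ε₀, hε₀pos, by linarith, N + 1, by omega, fun ε hε0 hε1 => ?_⟩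
  -- quantities at junk size `ε`
  have hε4 : ε ≤ 1 / (4 * K) := hε1.trans hε₀1
  have h2Kε : 2 * K * ε ≤ 1 / 2 := by
    have := mul_le_mul_of_nonneg_left hε4 (by positivity : (0 : ℝ) ≤ 2 * K)
    calc 2 * K * ε ≤ 2 * K * (1 / (4 * K)) := this
      _ = 1 / 2 := by field_simp; ring
  set e2 : ℝ := (1 - ε) ^ 2 with he2
  have he2low : 1 - 2 * ε ≤ e2 := by rw [he2]; nlinarith
  have he2K : 1 - 1 / (2 * K) ≤ e2 := by
    have : 2 * ε ≤ 1 / (2 * K) := by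
      rw [le_div_iff₀ (by positivity)]; linarith
    linarith
  have he2pos : 0 < e2 := lt_of_lt_of_le hden0 he2K
  have hgap : 1 / K - 2 * ε ≤ e2 - (1 - 1 / K) := by linarith
  have hgap0 : 0 < e2 - (1 - 1 / K) := by
    have : 1 / (2 * K) < 1 / K := one_div_lt_one_div_of_lt hK0 (by linarith)
    linarith
  have hKD : (0 : ℝ) < 1 - K + K * e2 := by
    have h := mul_pos hK0 hgap0
    have : K * (e2 - (1 - 1 / K)) = 1 - K + K * e2 := by field_simp; ring
    linarith
  have hKDne : 1 - K + K * e2 ≠ 0 := hKD.ne'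
  set θ : ℝ := (1 - 1 / K) / e2 with hθ
  set Qs : ℝ := (1 / K) / (e2 - (1 - 1 / K)) with hQs
  set Q₁ : ℝ := K / e2 with hQ₁
  have hθθ₀ : θ ≤ θ₀ := div_le_div_of_nonneg_left hnum0 hden0 he2K
  have hθ0 : 0 ≤ θ := div_nonneg hnum0 he2pos.le
  have hθ1 : θ < 1 := lt_of_le_of_lt hθθ₀ hθ₀1
  -- the fixed point identity `1/K/e2 + θ Qs = Qs`
  have hfix : 1 / K / e2 + θ * Qs = Qs := by
    rw [hθ, hQs]
    field_simp [hKDne, he2pos.ne', hK0.ne']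
    have hXinv : (1 - K + K * e2) * (1 - K + K * e2)⁻¹ = 1 := mul_inv_cancel₀ hKDne
    linear_combination (-1 : ℝ) * hXinv
  refine ⟨fun l => Qs + θ ^ (l - 1) * (Q₁ - Qs), ?_, fun l hl => ?_, ?_⟩
  · simp only [Nat.sub_self, pow_zero, one_mul, add_sub_cancel]
    exact le_of_eq (by rw [hQ₁])
  · -- the recursion holds with equality
    apply le_of_eq
    have hl' : l + 1 - 1 = l - 1 + 1 := by omega
    simp only [hl', pow_succ]
    have : (1 / K + (1 - 1 / K) * (Qs + θ ^ (l - 1) * (Q₁ - Qs))) / e2 =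
        (1 / K / e2 + θ * Qs) + θ ^ (l - 1) * θ * (Q₁ - Qs) := by
      rw [hθ]; field_simp; ring
    rw [this, hfix]
  · -- `Q (N+1) = Qs + θ^N (Q₁ − Qs) ≤ 1 + δ`
    simp only [Nat.add_sub_cancel]
    have hQs_le : Qs ≤ 1 + δ / 2 := by
      -- `Qs ≤ (1/K)/(1/K − 2ε) = 1/(1 − 2Kε) ≤ 1 + 4Kε ≤ 1 + δ/2`
      have hlow : 0 < 1 / K - 2 * ε := by
        have : 2 * ε ≤ 1 / (2 * K) := by rw [le_div_iff₀ (by positivity)]; linarith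
        have : 1 / (2 * K) < 1 / K := one_div_lt_one_div_of_lt hK0 (by linarith)
        linarith
      have h1 : Qs ≤ (1 / K) / (1 / K - 2 * ε) := div_le_div_of_nonneg_left (by positivity) hlow hgap
      have hne2 : 1 - 2 * K * ε ≠ 0 := by linarith
      have hne3 : 1 / K - 2 * ε ≠ 0 := hlow.ne'
      have h2 : (1 / K) / (1 / K - 2 * ε) = 1 / (1 - 2 * K * ε) := by
        rw [div_eq_div_iff hne3 hne2]
        field_simp
      have h3 : 1 / (1 - 2 * K * ε) ≤ 1 + 4 * K * ε := by
        rw [div_le_iff₀ (by linarith)]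
        nlinarith [mul_nonneg (by positivity : (0 : ℝ) ≤ 2 * K) hε0]
      have h4 : 4 * K * ε ≤ δ / 2 := by
        have := mul_le_mul_of_nonneg_left (hε1.trans hε₀2) (by positivity : (0 : ℝ) ≤ 4 * K)
        calc 4 * K * ε ≤ 4 * K * (δ / (8 * K)) := this
          _ = δ / 2 := by field_simp; ring
      linarith
    have htail : θ ^ N * (Q₁ - Qs) ≤ δ / 2 := by
      by_cases hneg : Q₁ - Qs ≤ 0
      · exact (mul_nonpos_of_nonneg_of_nonpos (pow_nonneg hθ0 N) hneg).trans (by positivity)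
      · push Not at hneg
        have hQ₁le : Q₁ ≤ 2 * K := by
          rw [hQ₁, div_le_iff₀ he2pos]
          have : (1 : ℝ) / 2 ≤ e2 := by
            have : 2 * ε ≤ 1 / 2 := by
              have : 2 * ε ≤ 1 / (2 * K) := by rw [le_div_iff₀ (by positivity)]; linarith
              have : 1 / (2 * K) ≤ 1 / 2 := one_div_le_one_div_of_le (by norm_num) (by linarith)
              linarith
            linarith
          nlinarith
        have hQs0 : 0 ≤ Qs := div_nonneg (by positivity) hgap0.le
        calc θ ^ N * (Q₁ - Qs) ≤ θ₀ ^ N * (2 * K) := by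
              refine mul_le_mul (pow_le_pow_left₀ hθ0 hθθ₀ N) (by linarith) hneg.le (pow_nonneg hθ₀0 N)
          _ ≤ δ / (4 * K) * (2 * K) := mul_le_mul_of_nonneg_right hN.le (by positivity)
          _ = δ / 2 := by field_simp; ring
    linarith

end Summit.CriticalPhenomena.PercolationContinuityZ3.Theorems.Crossing

end
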